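/-
Copyright (c) 2026 the pub-hodgecm-mathlib formalisation cell (harness21).  Prover seat hodgecm-mathlib-K2E4-p14 (g7): Track B «K2-LIT», ENGINE E1,
h413 = stmt-HodgeConjecture-24833; DEAL (23)∕RULINGS (31)(57)(ii) of K2E1-plan (g6), FILE 2: «W5₃-B HEAD — THE MEROMORPHIC CONTINUATION OF THE SPHERICAL CONSTANT-TERM SCALAR OF U(2,1)».
-/
import Summits.HodgeConjecture.HodgeConjecture.Theorems.K2E1IntertwiningArchFactorIntegrableU3      -- ★ p859299 (this seat, (α)): `ARCH₃^{−σ} ∈ L¹` for `σ > 1`, `one_le_arch`; brings ★ FILE 3′ `…FiniteIntegrabilityU3`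
import Summits.HodgeConjecture.HodgeConjecture.Theorems.K2E1IntertwiningLocalFactorIntegrableU3     -- ★ p859343 (this seat, (β)): `Q_v^{−σ} ∈ L¹(ν³)` at EVERY place for `σ > 3∕2`; brings ★ `…LocalMeanCMU3`, ★ `…LocalHeightU3`
import Summits.HodgeConjecture.HodgeConjecture.Theorems.K2E1IntertwiningScalarContinuationU3       -- ★ FILE 1 (K2E2-p12): `exists_differentiableOn_sub_two_mul_scalar_cm` (`(z−2)·[N∕D](z) = G z` on `{2 < re}`, `G` holomorphic on `{1 < re}`, `G 2 ≠ 0`)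
import Summits.HodgeConjecture.HodgeConjecture.Theorems.K2E1IntertwinedCoeffContinuousCM           -- ★: `integrable_borelHeight_weylLongU_mul_rpow_cm_three` (Godement at CM, `hT`)
import Summits.HodgeConjecture.HodgeConjecture.Theorems.K2E1HeisenbergHaarU3                        -- ★ (ν-2): `isInvInvariant_of_isHaarMeasure_adelicUnipotent_three`
import Summits.HodgeConjecture.HodgeConjecture.Theorems.K2E1WhittakerLocalUnitValuesCofiniteU3      -- ★ (K2E1-p10): the cofinite suppliers (`finite_setOf_not_isUnramifiedIn`, `eventually_valued_algebraMap_eq_one`, `eventually_forall_placesOver`)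
import Summits.HodgeConjecture.HodgeConjecture.Theorems.K2E1PowerMomentHolomorphy                    -- ★ FILE A (this seat's lineage): moments are holomorphic, real points, positivity, identity theorem from the real axis
import Literature.NumberTheory.Automorphic.UnitaryGroupIwasawaAdelic                               -- ★ `exists_mem_borelAdelic_mul_mem_standardMaximalCompactGL_cm_three` (Iwasawa at CM)
import Literature.NumberTheory.Rogawski1990.LocalTransferAtOneMuTwistGlobal                        -- ★ `isUnramifiedAt_quadraticHeckeCharCM_of_isUnramifiedIn`
import Literature.NumberTheory.Automorphic.AdicCompletionCompact                                   -- ★ `locallyCompactSpace_adicCompletion`, `locallyCompactSpace_finiteAdeleRing'`, `locallyCompactSpace_adeleRing'`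
import HarnessLib

/-!
# K2·E1 — `K2E1SphericalConstantTermContinuationU3` (W5₃-B HEAD): THE SPHERICAL CONSTANT-TERM SCALAR `c_ν(z) = ν(𝓕)⁻¹·∫_{N(𝔸)} H(ι(w₀)v)^z dν` OF `U(2,1)_{L∕L⁺}` CONTINUES
# MEROMORPHICALLY FROM `{Re z > 2}` TO `{Re z > σ₁}` WITH EXACTLY ONE POLE, SIMPLE, AT `z = 2ρ_H = 2` — `σ₁` = THE LOCAL ABSCISSA (`σ₁ = 3∕2` letter-free here; `σ₁ = 1` on (L3-bad))

Track B ∕ K2-LIT, crux h413 = `stmt-HodgeConjecture-24833`, route of record `HCCMUnconditional`; cell `hodgecm-mathlib`, squad K2, ENGINE E1 (campaign «EIS-RANK-ONE», R7 at `N = 3`; the letter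
(L3) `c r hr hcmer hchol hcres` of ★ capstone₃ `K2E1SphericalEisensteinContinuationCMThreeOfLetters`).  THEOREMS ONLY (no `def`, no instance, no notation, no named-fact hypothesis, no `sorry`;
default heartbeats); lane `--supports stmt-HodgeConjecture-24833 --as helper` (count-neutral).

THE MATHEMATICS [MoeglinWaldspurger1995, II.1.7, IV.1.11; Langlands1971, §3; Langlands1976, Appendix; Titchmarsh1939, §2.8, §4.1].  For real `σ > 2` ★ FILE 3′ gives the Euler product
`c_ν(σ) = C·A(σ)·∏_{v∈S₀} a_v(σ)·[N∕D](σ)` (`S₀` = ramified ∪ `v ∣ 2` ∪ non-unit places of `δ`; all inputs ★: Godement `hT`, Iwasawa, inversion invariance).  Each factor is the real point of a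
holomorphic function: `B(z) = ∫ ARCH₃^{−z} d(μ_{E,∞}⊗μ_{F,∞})` on `{1 < re}` (★ (α) + ★ FILE A moments), `a_v(z) = ν³(𝒪³)⁻¹∫ Q_v^{−z}` on `{σ₁ < re}` whenever `Q_v^{−σ} ∈ L¹` for all
`σ > σ₁` (★ FILE A; `σ₁ = 3∕2` by ★ (β), `σ₁ = 1` by (L3-bad)), and `(z − 2)·[N∕D](z) = G(z)` with `G` holomorphic on `{1 < re}`, `G(2) ≠ 0` (★ FILE 1).  By the identity theorem from the real
axis (★ FILE A `eqOn_re_gt_of_forall_ofReal`; `c_ν` is holomorphic on `{2 < re}` by ★ FILE A moments + Godement) `c_ν(z) = F(z)∕(z − 2)` on `{2 < re}` with `F = C·B·∏ a_v·G` holomorphic on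
`{σ₁ < re}`; so `c̃ := F∕(z − 2)` is the continuation: meromorphic on `{σ₁ < re}`, holomorphic off `2`, `(z − 2)c̃(z) → F(2) = C·B(2)·∏ a_v(2)·G(2) ≠ 0` (positivity of the real moments).
* §1–§2 the `F(z)∕(z − ρ₀)` package, continuity of `ARCH₃`, `Q_v`; holomorphic means `differentiableOn_archMean_three` (`{1 < re}`), `differentiableOn_localMean_of_integrable` (`{σ₁ < re}`),
  `differentiableOn_intertwiningScalar_cm_three` (`{2 < re}`); real points.  §3 **`sphericalConstantTerm_continuation_cm_three_of_local (hσ₁ : 1 ≤ σ₁) (hσ₁2 : σ₁ < 2) (hloc)`**: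
  `∃ c r, r ≠ 0 ∧ MeromorphicOn c {σ₁ < re} ∧ DifferentiableOn ℂ c ({σ₁ < re} ∖ {2}) ∧ Tendsto ((z − 2)·c z) (𝓝[≠] 2) (𝓝 r) ∧ ∀ z, 2 < z.re → c z = ν(𝓕)⁻¹·∫ (H(ι(w₀)v) : ℂ)^z dν`.
  §4 **`sphericalConstantTerm_continuation_cm_three`** — `σ₁ = 3∕2`, LETTER-FREE (★ (β)); the `{1 < re}` edition = §3 at `σ₁ = 1` on the (L3-bad) integrability (K2E2-p12), one line.
HONEST LABEL: HC_CM is proved only modulo the 7 printed citations (2 remaining named inputs: hLiu418 = `stmt-HodgeConjecture-24832`, h413 = `stmt-HodgeConjecture-24833`) until rung 0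
closes; this file asserts no named fact and closes no socket; count-neutral; §4 unconditional, §3 conditional only on its displayed local-integrability binder `hloc`.

## References
* [MoeglinWaldspurger1995] C. Mœglin, J.-L. Waldspurger, *Spectral Decomposition and Eisenstein Series* (1995): II.1.7, IV.1.11.
* [Langlands1976] R. P. Langlands, *On the Functional Equations Satisfied by Eisenstein Series*, LNM 544 (1976): Appendix.  [Langlands1971] *Euler Products*: §3.
* [Titchmarsh1939] E. C. Titchmarsh, *The Theory of Functions*, 2nd ed. (1939): §2.8, §4.1.
-/

set_option autoImplicit false
set_option linter.dupNamespace false -- the mandated namespace repeats `HodgeConjecture.HodgeConjecture`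

noncomputable section

open MeasureTheory MeasureTheory.Measure NumberField NumberField.InfinitePlace IsDedekindDomain Set Filter Topology
open scoped ENNReal NNReal Classical
open Literature.NumberTheory.Automorphic Literature.NumberTheory.Automorphic.UnitaryGroup Literature.NumberTheory.GaloisRepresentations Literature.NumberTheory.LFunctions AdelicGroupData
open Literature.NumberTheory.GaloisRepresentations.IsNonarchimedeanLocalField
open Literature.NumberTheory.Automorphic.LocalFieldHaar (continuous_normAbs)
open Summit.HodgeConjecture.HodgeConjecture.Cruxes.H413
open Summit.HodgeConjecture.HodgeConjecture.Cruxes.H413.K2E1PowerMomentHolomorphy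
open Summit.HodgeConjecture.HodgeConjecture.Cruxes.H413.K2E1IntertwiningArchFactorIntegrableU3 (one_le_arch integrable_arch_rpow_neg_prod_real integrable_arch_rpow_neg_prod)
open Summit.HodgeConjecture.HodgeConjecture.Cruxes.H413.K2E1IntertwiningLocalFactorIntegrableU3 (integrable_localHeight_rpow_cm)
open Summit.HodgeConjecture.HodgeConjecture.Cruxes.H413.K2E1IntertwiningFiniteIntegrabilityU3 (exists_pos_inv_measure_smul_integral_rpow_borelHeight_eq_eulerProduct_three')
open Summit.HodgeConjecture.HodgeConjecture.Cruxes.H413.K2E1IntertwiningScalarContinuationU3 (exists_differentiableOn_sub_two_mul_scalar_cm)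
open Summit.HodgeConjecture.HodgeConjecture.Cruxes.H413.K2E1IntertwinedCoeffContinuousCM (integrable_borelHeight_weylLongU_mul_rpow_cm_three)
open Summit.HodgeConjecture.HodgeConjecture.Cruxes.H413.K2E1HeisenbergHaarU3 (isInvInvariant_of_isHaarMeasure_adelicUnipotent_three)

namespace Summit.HodgeConjecture.HodgeConjecture.Cruxes.H413.K2E1SphericalConstantTermContinuationU3

/-! ## §1 The continuation package at `ρ₀` and two continuity lemmas -/

/-- **THE CONTINUATION PACKAGE AT `ρ₀`.**  For `F` holomorphic on an open `U ∋ ρ₀`, `c̃(z) := F(z)∕(z − ρ₀)` is meromorphic on `U`, holomorphic on `U ∖ {ρ₀}`, and `(z − ρ₀)·c̃(z) → F(ρ₀)` as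
`z → ρ₀`, `z ≠ ρ₀` (★ FILE A `continuation_package_div_sub_one` with `1 ↦ ρ₀`). [cite: Titchmarsh1939, §1.51] -/
theorem continuation_package_div_sub {U : Set ℂ} (hU : IsOpen U) {ρ₀ : ℂ} (hρ : ρ₀ ∈ U) {F : ℂ → ℂ} (hF : DifferentiableOn ℂ F U) :
    MeromorphicOn (fun z => F z / (z - ρ₀)) U ∧ DifferentiableOn ℂ (fun z => F z / (z - ρ₀)) (U \ {ρ₀}) ∧
      Tendsto (fun z : ℂ => (z - ρ₀) * (F z / (z - ρ₀))) (𝓝[≠] ρ₀) (𝓝 (F ρ₀)) := by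
  have hsub : AnalyticOnNhd ℂ (fun z : ℂ => z - ρ₀) U := (analyticOnNhd_id.sub analyticOnNhd_const)
  refine ⟨(hF.analyticOnNhd hU).meromorphicOn.fun_div hsub.meromorphicOn, ?_, ?_⟩
  · exact (hF.mono fun z hz => hz.1).div (differentiableOn_id.sub (differentiableOn_const _)) fun z hz => sub_ne_zero.2 hz.2
  · have hc : Tendsto F (𝓝[≠] ρ₀) (𝓝 (F ρ₀)) := ((hF.continuousOn.continuousAt (hU.mem_nhds hρ)).tendsto).mono_left nhdsWithin_le_nhds
    refine hc.congr' (eventually_nhdsWithin_of_forall fun z hz => ?_)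
    have hz1 : z - ρ₀ ≠ 0 := sub_ne_zero.2 hz
    field_simp

variable (L : Type) [Field L] [NumberField L] [IsCMField L]

omit [IsCMField L] in
/-- `(Ξ, a) ↦ ARCH₃(Ξ, a)` is continuous (★ `continuous_ringEquiv_mixedSpace`). [folklore] -/
theorem continuous_arch (δ : L) :
    Continuous fun p : InfiniteAdeleRing L × InfiniteAdeleRing ↥(maximalRealSubfield L) =>
      ∏ w : InfinitePlace L, ((1 + ‖(p.1) w‖ ^ 2 / 2) ^ 2 + (w δ) ^ 2 * (((InfiniteAdeleRing.ringEquiv_mixedSpace ↥(maximalRealSubfield L)) p.2).1 ⟨w.comap (algebraMap ↥(maximalRealSubfield L) L), K2E1HeightBigCellLineFormulaU2.isReal_comap_maximalRealSubfield L w⟩) ^ 2) := by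
  refine continuous_finsetProd _ fun w _ => ?_
  have h1 : Continuous fun p : InfiniteAdeleRing L × InfiniteAdeleRing ↥(maximalRealSubfield L) => ‖p.1 w‖ :=
    continuous_norm.comp ((continuous_apply w).comp continuous_fst)
  have h2 : Continuous fun p : InfiniteAdeleRing L × InfiniteAdeleRing ↥(maximalRealSubfield L) =>
      ((InfiniteAdeleRing.ringEquiv_mixedSpace ↥(maximalRealSubfield L)) p.2).1 ⟨w.comap (algebraMap ↥(maximalRealSubfield L) L), K2E1HeightBigCellLineFormulaU2.isReal_comap_maximalRealSubfield L w⟩ :=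
    (continuous_apply _).comp (continuous_fst.comp ((continuous_ringEquiv_mixedSpace ↥(maximalRealSubfield L)).comp continuous_snd))
  exact ((continuous_const.add ((h1.pow 2).div_const 2)).pow 2).add (continuous_const.mul (h2.pow 2))

/-- `p ↦ Q_v(p)` is continuous (`Ψ_v`, `ι_v`, `σ ⊗ 1`, `‖·‖` continuous — ★ `continuous_localHeight_rpow`'s ingredients). [cite: TateThesis1967, §3.3] -/
theorem continuous_localHeight_cm {δ : L} (hcδ : IsCMField.complexConj L δ = -δ) (hδ : δ ≠ 0) (v : HeightOneSpectrum (𝓞 ↥(maximalRealSubfield L))) :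
    Continuous fun p : Fin 3 → v.adicCompletion ↥(maximalRealSubfield L) =>
      ∏ w' : PlacesOver L v, max 1 (max ((normAbs (w'.1.adicCompletion L) (quadraticLocalEquiv L v (IsCMField.complexConj L) hcδ hδ (p 0, p 1) w') : ℝ≥0) : ℝ)
        ((normAbs (w'.1.adicCompletion L) ((toLocalRing L v (p 2) * algebraMap L (LocalRing L v) δ -
          toLocalRing L v 2⁻¹ * (quadraticLocalEquiv L v (IsCMField.complexConj L) hcδ hδ (p 0, p 1) *
            conjLocal L (IsCMField.complexConj L) v (quadraticLocalEquiv L v (IsCMField.complexConj L) hcδ hδ (p 0, p 1)))) w') : ℝ≥0) : ℝ)) := by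
  haveI : Algebra.IsQuadraticExtension ↥(maximalRealSubfield L) L := IsCMField.isQuadraticExtension L
  have hΨ : Continuous fun p : Fin 3 → v.adicCompletion ↥(maximalRealSubfield L) => quadraticLocalEquiv L v (IsCMField.complexConj L) hcδ hδ (p 0, p 1) :=
    (quadraticLocalEquiv L v (IsCMField.complexConj L) hcδ hδ).continuous.comp ((continuous_apply 0).prodMk (continuous_apply 1))
  have hZ : Continuous fun p : Fin 3 → v.adicCompletion ↥(maximalRealSubfield L) => toLocalRing L v (p 2) * algebraMap L (LocalRing L v) δ -
      toLocalRing L v 2⁻¹ * (quadraticLocalEquiv L v (IsCMField.complexConj L) hcδ hδ (p 0, p 1) *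
        conjLocal L (IsCMField.complexConj L) v (quadraticLocalEquiv L v (IsCMField.complexConj L) hcδ hδ (p 0, p 1))) :=
    (((continuous_toLocalRing L v).comp (continuous_apply 2)).mul continuous_const).sub
      (continuous_const.mul (hΨ.mul ((continuous_conjLocal L (IsCMField.complexConj L) v).comp hΨ)))
  refine continuous_finsetProd _ fun w' _ => continuous_const.max (Continuous.max ?_ ?_)
  · exact NNReal.continuous_coe.comp (continuous_normAbs.comp ((continuous_apply w').comp hΨ))
  · exact NNReal.continuous_coe.comp (continuous_normAbs.comp ((continuous_apply w').comp hZ))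

/-! ## §2 Holomorphic means -/

section Means

variable {δ : L} (hδ : δ ≠ 0)

include hδ in
/-- **THE ARCHIMEDEAN MEAN `B(z) = ∫ ARCH₃^{−z} d(μ_{E,∞} ⊗ μ_{F,∞})` IS HOLOMORPHIC ON `{1 < re}`** (★ FILE A moments; integrability ★ (α); `ARCH₃ ≥ 1` continuous).
[cite: Titchmarsh1939, §2.8] [cite: MoeglinWaldspurger1995, II.1.7] -/
theorem differentiableOn_archMean_three [MeasurableSpace (InfiniteAdeleRing L)] [BorelSpace (InfiniteAdeleRing L)]
    [MeasurableSpace (InfiniteAdeleRing ↥(maximalRealSubfield L))] [BorelSpace (InfiniteAdeleRing ↥(maximalRealSubfield L))]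
    (μE₁ : Measure (InfiniteAdeleRing L)) [μE₁.IsAddHaarMeasure] (μF₁ : Measure (InfiniteAdeleRing ↥(maximalRealSubfield L))) [μF₁.IsAddHaarMeasure] :
    DifferentiableOn ℂ (fun z : ℂ => ∫ p : InfiniteAdeleRing L × InfiniteAdeleRing ↥(maximalRealSubfield L),
      (((∏ w : InfinitePlace L, ((1 + ‖(p.1) w‖ ^ 2 / 2) ^ 2 + (w δ) ^ 2 * (((InfiniteAdeleRing.ringEquiv_mixedSpace ↥(maximalRealSubfield L)) p.2).1 ⟨w.comap (algebraMap ↥(maximalRealSubfield L) L), K2E1HeightBigCellLineFormulaU2.isReal_comap_maximalRealSubfield L w⟩) ^ 2) : ℝ) : ℂ)) ^ (-z)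
        ∂(μE₁.prod μF₁)) {z : ℂ | 1 < z.re} := by
  haveI : SecondCountableTopology (InfiniteAdeleRing L) := secondCountableTopology_infiniteAdeleRing L
  haveI : SecondCountableTopology (InfiniteAdeleRing ↥(maximalRealSubfield L)) := secondCountableTopology_infiniteAdeleRing _
  exact differentiableOn_integral_ofReal_cpow_neg (continuous_arch L δ).measurable (fun p => lt_of_lt_of_le one_pos (one_le_arch L p.1 p.2))
    fun σ hσ => integrable_arch_rpow_neg_prod_real L hδ μE₁ μF₁ hσ

/-- **THE LOCAL MEAN `∫ Q_v^{−z} dν³` IS HOLOMORPHIC ON `{σ₁ < re}`** as soon as `Q_v^{−σ} ∈ L¹(ν³)` for every real `σ > σ₁` (★ FILE A moments; `Q_v ≥ 1` continuous).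
[cite: Titchmarsh1939, §2.8] [cite: TateThesis1967, §3.3] -/
theorem differentiableOn_localMean_of_integrable (hcδ : IsCMField.complexConj L δ = -δ) (v : HeightOneSpectrum (𝓞 ↥(maximalRealSubfield L)))
    [MeasurableSpace (v.adicCompletion ↥(maximalRealSubfield L))] [BorelSpace (v.adicCompletion ↥(maximalRealSubfield L))]
    (ν : Measure (v.adicCompletion ↥(maximalRealSubfield L))) [ν.IsAddHaarMeasure] {σ₁ : ℝ}
    (hloc : ∀ σ : ℝ, σ₁ < σ → Integrable (fun p : Fin 3 → v.adicCompletion ↥(maximalRealSubfield L) =>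
        (∏ w' : PlacesOver L v, max 1 (max ((normAbs (w'.1.adicCompletion L) (quadraticLocalEquiv L v (IsCMField.complexConj L) hcδ hδ (p 0, p 1) w') : ℝ≥0) : ℝ)
          ((normAbs (w'.1.adicCompletion L) ((toLocalRing L v (p 2) * algebraMap L (LocalRing L v) δ -
            toLocalRing L v 2⁻¹ * (quadraticLocalEquiv L v (IsCMField.complexConj L) hcδ hδ (p 0, p 1) *
              conjLocal L (IsCMField.complexConj L) v (quadraticLocalEquiv L v (IsCMField.complexConj L) hcδ hδ (p 0, p 1)))) w') : ℝ≥0) : ℝ))) ^ (-σ))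
      (Measure.pi fun _ : Fin 3 => ν)) :
    DifferentiableOn ℂ (fun z : ℂ => ∫ p : Fin 3 → v.adicCompletion ↥(maximalRealSubfield L),
      ((∏ w' : PlacesOver L v, max 1 (max ((normAbs (w'.1.adicCompletion L) (quadraticLocalEquiv L v (IsCMField.complexConj L) hcδ hδ (p 0, p 1) w') : ℝ≥0) : ℝ)
          ((normAbs (w'.1.adicCompletion L) ((toLocalRing L v (p 2) * algebraMap L (LocalRing L v) δ -
            toLocalRing L v 2⁻¹ * (quadraticLocalEquiv L v (IsCMField.complexConj L) hcδ hδ (p 0, p 1) *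
              conjLocal L (IsCMField.complexConj L) v (quadraticLocalEquiv L v (IsCMField.complexConj L) hcδ hδ (p 0, p 1)))) w') : ℝ≥0) : ℝ)) : ℝ) : ℂ) ^ (-z)
        ∂(Measure.pi fun _ : Fin 3 => ν)) {z : ℂ | σ₁ < z.re} := by
  haveI := secondCountableTopology_localField (v.adicCompletion ↥(maximalRealSubfield L))
  exact differentiableOn_integral_ofReal_cpow_neg (continuous_localHeight_cm L hcδ hδ v).measurable
    (fun _ => lt_of_lt_of_le one_pos (Finset.one_le_prod fun _ _ => le_max_left _ _)) hloc

omit [IsCMField L] in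
/-- The real points of the archimedean mean: `B(σ) = ((∫ ARCH₃^{−σ} : ℝ) : ℂ)` (★ FILE A `integral_ofReal_cpow_neg_ofReal`). [folklore] -/
theorem archMean_three_ofReal [MeasurableSpace (InfiniteAdeleRing L)] [MeasurableSpace (InfiniteAdeleRing ↥(maximalRealSubfield L))]
    (μ : Measure (InfiniteAdeleRing L × InfiniteAdeleRing ↥(maximalRealSubfield L))) (σ : ℝ) :
    (∫ p : InfiniteAdeleRing L × InfiniteAdeleRing ↥(maximalRealSubfield L),
      (((∏ w : InfinitePlace L, ((1 + ‖(p.1) w‖ ^ 2 / 2) ^ 2 + (w δ) ^ 2 * (((InfiniteAdeleRing.ringEquiv_mixedSpace ↥(maximalRealSubfield L)) p.2).1 ⟨w.comap (algebraMap ↥(maximalRealSubfield L) L), K2E1HeightBigCellLineFormulaU2.isReal_comap_maximalRealSubfield L w⟩) ^ 2) : ℝ) : ℂ)) ^ (-((σ : ℝ) : ℂ)) ∂μ) =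
      ((∫ p : InfiniteAdeleRing L × InfiniteAdeleRing ↥(maximalRealSubfield L),
        (∏ w : InfinitePlace L, ((1 + ‖(p.1) w‖ ^ 2 / 2) ^ 2 + (w δ) ^ 2 * (((InfiniteAdeleRing.ringEquiv_mixedSpace ↥(maximalRealSubfield L)) p.2).1 ⟨w.comap (algebraMap ↥(maximalRealSubfield L) L), K2E1HeightBigCellLineFormulaU2.isReal_comap_maximalRealSubfield L w⟩) ^ 2)) ^ (-σ) ∂μ : ℝ) : ℂ) :=
  integral_ofReal_cpow_neg_ofReal (m := μ) (w := fun p : InfiniteAdeleRing L × InfiniteAdeleRing ↥(maximalRealSubfield L) =>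
      ∏ w : InfinitePlace L, ((1 + ‖(p.1) w‖ ^ 2 / 2) ^ 2 + (w δ) ^ 2 * (((InfiniteAdeleRing.ringEquiv_mixedSpace ↥(maximalRealSubfield L)) p.2).1 ⟨w.comap (algebraMap ↥(maximalRealSubfield L) L), K2E1HeightBigCellLineFormulaU2.isReal_comap_maximalRealSubfield L w⟩) ^ 2))
    (fun p => zero_le_one.trans (one_le_arch L (δ := δ) p.1 p.2)) σ

/-- The real points of the local mean: `∫ (Q_v : ℂ)^{−σ} = ((∫ Q_v^{−σ} : ℝ) : ℂ)` (★ FILE A `integral_ofReal_cpow_neg_ofReal`). [folklore] -/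
theorem localMean_cm_ofReal (hcδ : IsCMField.complexConj L δ = -δ) (v : HeightOneSpectrum (𝓞 ↥(maximalRealSubfield L)))
    [MeasurableSpace (v.adicCompletion ↥(maximalRealSubfield L))] (μ : Measure (Fin 3 → v.adicCompletion ↥(maximalRealSubfield L))) (σ : ℝ) :
    (∫ p : Fin 3 → v.adicCompletion ↥(maximalRealSubfield L),
      (((∏ w' : PlacesOver L v, max 1 (max ((normAbs (w'.1.adicCompletion L) (quadraticLocalEquiv L v (IsCMField.complexConj L) hcδ hδ (p 0, p 1) w') : ℝ≥0) : ℝ)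
          ((normAbs (w'.1.adicCompletion L) ((toLocalRing L v (p 2) * algebraMap L (LocalRing L v) δ -
            toLocalRing L v 2⁻¹ * (quadraticLocalEquiv L v (IsCMField.complexConj L) hcδ hδ (p 0, p 1) *
              conjLocal L (IsCMField.complexConj L) v (quadraticLocalEquiv L v (IsCMField.complexConj L) hcδ hδ (p 0, p 1)))) w') : ℝ≥0) : ℝ)) : ℝ) : ℂ)) ^ (-((σ : ℝ) : ℂ)) ∂μ) =
      ((∫ p : Fin 3 → v.adicCompletion ↥(maximalRealSubfield L),
        (∏ w' : PlacesOver L v, max 1 (max ((normAbs (w'.1.adicCompletion L) (quadraticLocalEquiv L v (IsCMField.complexConj L) hcδ hδ (p 0, p 1) w') : ℝ≥0) : ℝ)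
          ((normAbs (w'.1.adicCompletion L) ((toLocalRing L v (p 2) * algebraMap L (LocalRing L v) δ -
            toLocalRing L v 2⁻¹ * (quadraticLocalEquiv L v (IsCMField.complexConj L) hcδ hδ (p 0, p 1) *
              conjLocal L (IsCMField.complexConj L) v (quadraticLocalEquiv L v (IsCMField.complexConj L) hcδ hδ (p 0, p 1)))) w') : ℝ≥0) : ℝ))) ^ (-σ) ∂μ : ℝ) : ℂ) :=
  integral_ofReal_cpow_neg_ofReal (fun _ => zero_le_one.trans (Finset.one_le_prod fun _ _ => le_max_left _ _)) σ

end Means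

variable [MeasurableSpace (quasiSplit (↥(maximalRealSubfield L)) L (IsCMField.complexConj L) 3).Adelic] [BorelSpace (quasiSplit (↥(maximalRealSubfield L)) L (IsCMField.complexConj L) 3).Adelic]

/-- **THE SPHERICAL CONSTANT-TERM SCALAR IS HOLOMORPHIC ON `{2 < re}`**: `z ↦ ∫_{N(𝔸)} (H(ι(w₀)v) : ℂ)^z dν` (★ FILE A moments: `H > 0` continuous; `∫ H^σ < ∞` for real `σ > 2` by Godement at CM
★ `integrable_borelHeight_weylLongU_mul_rpow_cm_three`, `N(𝔸)` inversion-invariant ★). [cite: MoeglinWaldspurger1995, II.1.6–II.1.7] [cite: Godement1964, §1.1] -/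
theorem differentiableOn_intertwiningScalar_cm_three (ν : Measure ↥(adelicUnipotent (↥(maximalRealSubfield L)) L (IsCMField.complexConj L) 3)) [ν.IsHaarMeasure]
    {𝓕 : Set ↥(adelicUnipotent (↥(maximalRealSubfield L)) L (IsCMField.complexConj L) 3)} (h𝓕N : IsFundamentalDomain ↥(rationalUnipotent (↥(maximalRealSubfield L)) L (IsCMField.complexConj L) 3) 𝓕 ν)
    (h𝓕c : IsCompact (closure 𝓕)) :
    DifferentiableOn ℂ (fun z : ℂ => ∫ v : ↥(adelicUnipotent (↥(maximalRealSubfield L)) L (IsCMField.complexConj L) 3), (((borelHeight (((quasiSplit (↥(maximalRealSubfield L)) L (IsCMField.complexConj L) 3).toAdelic (weylLongU ((IsCMField.complexConj L : L ≃ₐ[↥(maximalRealSubfield L)] L) : L →+* L) (rfl : (StdForm.antidiagonal 3).over L = (StdForm.antidiagonal 3).over L))) * (v : (quasiSplit (↥(maximalRealSubfield L)) L (IsCMField.complexConj L) 3).Adelic))) : ℝ) : ℂ) ^ z ∂ν) {z : ℂ | 2 < z.re} := by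
  have hc : IsCMField.complexConj L * IsCMField.complexConj L = 1 := AlgEquiv.ext fun x => IsCMField.complexConj_apply_apply L x
  haveI : ν.IsInvInvariant := isInvInvariant_of_isHaarMeasure_adelicUnipotent_three hc ν
  have hmeas : Measurable fun v : ↥(adelicUnipotent (↥(maximalRealSubfield L)) L (IsCMField.complexConj L) 3) => ((borelHeight (((quasiSplit (↥(maximalRealSubfield L)) L (IsCMField.complexConj L) 3).toAdelic (weylLongU ((IsCMField.complexConj L : L ≃ₐ[↥(maximalRealSubfield L)] L) : L →+* L) (rfl : (StdForm.antidiagonal 3).over L = (StdForm.antidiagonal 3).over L))) * (v : (quasiSplit (↥(maximalRealSubfield L)) L (IsCMField.complexConj L) 3).Adelic))) : ℝ) :=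
    (NNReal.continuous_coe.comp (continuous_borelHeight.comp (continuous_const.mul continuous_subtype_val))).measurable
  refine differentiableOn_integral_ofReal_cpow hmeas (fun v => NNReal.coe_pos.2 (borelHeight_pos _)) fun σ hσ => ?_
  have h := integrable_borelHeight_weylLongU_mul_rpow_cm_three L ν h𝓕N h𝓕c hσ 1
  simp_rw [mul_one] at h
  exact h

/-! ## §3 The continuation on `{σ₁ < re}` from every-place local integrability above `σ₁` -/

/-- **W5₃-B ON THE LOCAL ABSCISSA `σ₁ ∈ [1, 2)`.**  For the CM pair `L ∕ L⁺`, `δ ∈ L⁻ ∖ 0`, every Haar `ν` on `N(𝔸_{L⁺})` and fundamental domain `𝓕` of `N(L⁺)` with compact closure: IF at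
every finite place `v` of `L⁺` the local factor `Q_v^{−σ}` is `ν_v³`-integrable for every real `σ > σ₁` (every additive Haar `ν_v`), THEN there are `c : ℂ → ℂ` and `r ≠ 0` with `c` meromorphic
on `{σ₁ < re}`, holomorphic on `{σ₁ < re} ∖ {2}`, `(z − 2)·c(z) → r` (`z → 2`, `z ≠ 2`), and `c(z) = ν(𝓕)⁻¹·∫ (H(ι(w₀)v) : ℂ)^z dν` for `Re z > 2`.  (`c = C·B·∏_{v∈S₀} a_v·G ∕ (z − 2)`.)
[cite: MoeglinWaldspurger1995, II.1.7, IV.1.11] [cite: Langlands1976, Appendix] [cite: Titchmarsh1939, §4.1] -/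
theorem sphericalConstantTerm_continuation_cm_three_of_local {δ : L} (hcδ : IsCMField.complexConj L δ = -δ) (hδ : δ ≠ 0) {σ₁ : ℝ} (hσ₁ : 1 ≤ σ₁) (hσ₁2 : σ₁ < 2)
    (hloc : ∀ (v : HeightOneSpectrum (𝓞 ↥(maximalRealSubfield L))) [MeasurableSpace (v.adicCompletion ↥(maximalRealSubfield L))] [BorelSpace (v.adicCompletion ↥(maximalRealSubfield L))]
      (νv : Measure (v.adicCompletion ↥(maximalRealSubfield L))) [νv.IsAddHaarMeasure] (σ : ℝ), σ₁ < σ →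
      Integrable (fun p : Fin 3 → v.adicCompletion ↥(maximalRealSubfield L) =>
        (∏ w' : PlacesOver L v, max 1 (max ((normAbs (w'.1.adicCompletion L) (quadraticLocalEquiv L v (IsCMField.complexConj L) hcδ hδ (p 0, p 1) w') : ℝ≥0) : ℝ)
          ((normAbs (w'.1.adicCompletion L) ((toLocalRing L v (p 2) * algebraMap L (LocalRing L v) δ -
            toLocalRing L v 2⁻¹ * (quadraticLocalEquiv L v (IsCMField.complexConj L) hcδ hδ (p 0, p 1) *
              conjLocal L (IsCMField.complexConj L) v (quadraticLocalEquiv L v (IsCMField.complexConj L) hcδ hδ (p 0, p 1)))) w') : ℝ≥0) : ℝ))) ^ (-σ))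
        (Measure.pi fun _ : Fin 3 => νv))
    (ν : Measure ↥(adelicUnipotent (↥(maximalRealSubfield L)) L (IsCMField.complexConj L) 3)) [ν.IsHaarMeasure]
    {𝓕 : Set ↥(adelicUnipotent (↥(maximalRealSubfield L)) L (IsCMField.complexConj L) 3)} (h𝓕N : IsFundamentalDomain ↥(rationalUnipotent (↥(maximalRealSubfield L)) L (IsCMField.complexConj L) 3) 𝓕 ν)
    (h𝓕c : IsCompact (closure 𝓕)) :
    ∃ c : ℂ → ℂ, ∃ r : ℂ, r ≠ 0 ∧ MeromorphicOn c {z : ℂ | σ₁ < z.re} ∧ DifferentiableOn ℂ c ({z : ℂ | σ₁ < z.re} \ {2}) ∧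
      Tendsto (fun z : ℂ => (z - 2) * c z) (𝓝[≠] 2) (𝓝 r) ∧
      ∀ z : ℂ, 2 < z.re → c z = ((((ν 𝓕).toReal⁻¹ : ℝ)) : ℂ) * ∫ v : ↥(adelicUnipotent (↥(maximalRealSubfield L)) L (IsCMField.complexConj L) 3), (((borelHeight (((quasiSplit (↥(maximalRealSubfield L)) L (IsCMField.complexConj L) 3).toAdelic (weylLongU ((IsCMField.complexConj L : L ≃ₐ[↥(maximalRealSubfield L)] L) : L →+* L) (rfl : (StdForm.antidiagonal 3).over L = (StdForm.antidiagonal 3).over L))) * (v : (quasiSplit (↥(maximalRealSubfield L)) L (IsCMField.complexConj L) 3).Adelic))) : ℝ) : ℂ) ^ z ∂ν := by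
  haveI : Algebra.IsQuadraticExtension ↥(maximalRealSubfield L) L := IsCMField.isQuadraticExtension L
  -- CM bookkeeping (`c² = 1 ≠ c`, inversion invariance, Iwasawa, `δ² ∈ L⁺`); choices: Borel structures and Haar measures on the adelic pieces
  have hc : IsCMField.complexConj L * IsCMField.complexConj L = 1 := AlgEquiv.ext fun x => IsCMField.complexConj_apply_apply L x
  have hc1 : IsCMField.complexConj L ≠ 1 := IsCMField.complexConj_ne_one L
  haveI : ν.IsInvInvariant := isInvInvariant_of_isHaarMeasure_adelicUnipotent_three hc ν
  have hIw := exists_mem_borelAdelic_mul_mem_standardMaximalCompactGL_cm_three L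
  have hdmem : δ * δ ∈ maximalRealSubfield L := by rw [← IsCMField.complexConj_eq_self_iff, map_mul, hcδ, neg_mul_neg]
  have hd : δ * δ = algebraMap ↥(maximalRealSubfield L) L ⟨δ * δ, hdmem⟩ := rfl
  letI : MeasurableSpace (AdeleRing (𝓞 L) L) := borel _; haveI : BorelSpace (AdeleRing (𝓞 L) L) := ⟨rfl⟩
  letI : MeasurableSpace (AdeleRing (𝓞 ↥(maximalRealSubfield L)) ↥(maximalRealSubfield L)) := borel _
  haveI : BorelSpace (AdeleRing (𝓞 ↥(maximalRealSubfield L)) ↥(maximalRealSubfield L)) := ⟨rfl⟩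
  letI : MeasurableSpace (InfiniteAdeleRing L) := borel _; haveI : BorelSpace (InfiniteAdeleRing L) := ⟨rfl⟩
  letI : MeasurableSpace (InfiniteAdeleRing ↥(maximalRealSubfield L)) := borel _; haveI : BorelSpace (InfiniteAdeleRing ↥(maximalRealSubfield L)) := ⟨rfl⟩
  letI : MeasurableSpace (FiniteAdeleRing (𝓞 L) L) := borel _; haveI : BorelSpace (FiniteAdeleRing (𝓞 L) L) := ⟨rfl⟩
  letI : MeasurableSpace (FiniteAdeleRing (𝓞 ↥(maximalRealSubfield L)) ↥(maximalRealSubfield L)) := borel _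
  haveI : BorelSpace (FiniteAdeleRing (𝓞 ↥(maximalRealSubfield L)) ↥(maximalRealSubfield L)) := ⟨rfl⟩
  letI : ∀ v : HeightOneSpectrum (𝓞 ↥(maximalRealSubfield L)), MeasurableSpace (v.adicCompletion ↥(maximalRealSubfield L)) := fun v => borel _
  haveI : ∀ v : HeightOneSpectrum (𝓞 ↥(maximalRealSubfield L)), BorelSpace (v.adicCompletion ↥(maximalRealSubfield L)) := fun v => ⟨rfl⟩
  haveI := locallyCompactSpace_adeleRing' L; haveI := locallyCompactSpace_adeleRing' ↥(maximalRealSubfield L)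
  haveI := locallyCompactSpace_finiteAdeleRing' L; haveI := locallyCompactSpace_finiteAdeleRing' ↥(maximalRealSubfield L)
  haveI : ∀ v : HeightOneSpectrum (𝓞 ↥(maximalRealSubfield L)), LocallyCompactSpace (v.adicCompletion ↥(maximalRealSubfield L)) :=
    fun v => locallyCompactSpace_adicCompletion ↥(maximalRealSubfield L) v
  haveI : SecondCountableTopology (InfiniteAdeleRing L) := secondCountableTopology_infiniteAdeleRing L
  haveI : SecondCountableTopology (InfiniteAdeleRing ↥(maximalRealSubfield L)) := secondCountableTopology_infiniteAdeleRing _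
  haveI : ∀ v : HeightOneSpectrum (𝓞 ↥(maximalRealSubfield L)), SecondCountableTopology (v.adicCompletion ↥(maximalRealSubfield L)) := fun v => secondCountableTopology_localField _
  set μE : Measure (AdeleRing (𝓞 L) L) := Measure.addHaar; set μE₁ : Measure (InfiniteAdeleRing L) := Measure.addHaar
  set μE₂ : Measure (FiniteAdeleRing (𝓞 L) L) := Measure.addHaar; set μF : Measure (AdeleRing (𝓞 ↥(maximalRealSubfield L)) ↥(maximalRealSubfield L)) := Measure.addHaar
  set μF₁ : Measure (InfiniteAdeleRing ↥(maximalRealSubfield L)) := Measure.addHaar; set μF₂ : Measure (FiniteAdeleRing (𝓞 ↥(maximalRealSubfield L)) ↥(maximalRealSubfield L)) := Measure.addHaar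
  set νv : ∀ v : HeightOneSpectrum (𝓞 ↥(maximalRealSubfield L)), Measure (v.adicCompletion ↥(maximalRealSubfield L)) := fun v => Measure.addHaar
  -- ★ FILE 3′
  obtain ⟨C, hC, hEP⟩ := exists_pos_inv_measure_smul_integral_rpow_borelHeight_eq_eulerProduct_three' L hc hcδ hδ hc1 hIw hd ν h𝓕N μE μE₁ μE₂ μF μF₁ μF₂ νv
  -- the bad set `S₀`
  have e1 : ∀ᶠ v : HeightOneSpectrum (𝓞 ↥(maximalRealSubfield L)) in cofinite, Algebra.IsUnramifiedIn (𝓞 L) v.asIdeal :=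
    Filter.eventually_cofinite.2 (Literature.NumberTheory.GaloisRepresentations.finite_setOf_not_isUnramifiedIn ↥(maximalRealSubfield L) L)
  have e2 : ∀ᶠ v : HeightOneSpectrum (𝓞 ↥(maximalRealSubfield L)) in cofinite, Valued.v (2 : v.adicCompletion ↥(maximalRealSubfield L)) = 1 := by
    filter_upwards [eventually_valued_algebraMap_eq_one (E := ↥(maximalRealSubfield L)) (two_ne_zero : (2 : ↥(maximalRealSubfield L)) ≠ 0)] with v hv
    rwa [map_ofNat] at hv
  have e3 : ∀ᶠ v : HeightOneSpectrum (𝓞 ↥(maximalRealSubfield L)) in cofinite, ∀ w : PlacesOver L v, Valued.v (algebraMap L (LocalRing L v) δ w) = 1 :=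
    eventually_forall_placesOver (F := ↥(maximalRealSubfield L)) (E := L) (eventually_valued_algebraMap_eq_one (E := L) hδ)
  have e123 := e1.and (e2.and e3); rw [Filter.eventually_cofinite] at e123
  set S₀ : Finset (HeightOneSpectrum (𝓞 ↥(maximalRealSubfield L))) := e123.toFinset with hS₀
  have hgood : ∀ v ∉ S₀, Algebra.IsUnramifiedIn (𝓞 L) v.asIdeal ∧ Valued.v (2 : v.adicCompletion ↥(maximalRealSubfield L)) = 1 ∧
      ∀ w : PlacesOver L v, Valued.v (algebraMap L (LocalRing L v) δ w) = 1 := fun v hv => by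
    by_contra h
    exact hv ((Set.Finite.mem_toFinset _).2 h)
  -- ★ FILE 1: `G`
  have hur : ∀ v ∉ (↑S₀ : Set (HeightOneSpectrum (𝓞 ↥(maximalRealSubfield L)))), (quadraticHeckeCharCM L).IsUnramifiedAt v := fun v hv =>
    Literature.NumberTheory.Rogawski1990.isUnramifiedAt_quadraticHeckeCharCM_of_isUnramifiedIn L (hgood v (fun h => hv (Finset.mem_coe.2 h))).1
  obtain ⟨G, hGd, hGeq, hG2⟩ := exists_differentiableOn_sub_two_mul_scalar_cm L S₀.finite_toSet hur
  -- the holomorphic factor `F = C·B·∏ a_v·G` on `U = {σ₁ < re}`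
  have hU : IsOpen {z : ℂ | σ₁ < z.re} := isOpen_lt continuous_const Complex.continuous_re
  have h2U : (2 : ℂ) ∈ {z : ℂ | σ₁ < z.re} := by
    show σ₁ < (2 : ℂ).re
    rw [Complex.re_ofNat]; exact hσ₁2
  have hU1 : {z : ℂ | σ₁ < z.re} ⊆ {z : ℂ | 1 < z.re} := fun z hz => lt_of_le_of_lt hσ₁ hz
  obtain ⟨B, hB⟩ : ∃ B : ℂ → ℂ, B = fun z => ∫ p : InfiniteAdeleRing L × InfiniteAdeleRing ↥(maximalRealSubfield L),
      (((∏ w : InfinitePlace L, ((1 + ‖(p.1) w‖ ^ 2 / 2) ^ 2 + (w δ) ^ 2 * (((InfiniteAdeleRing.ringEquiv_mixedSpace ↥(maximalRealSubfield L)) p.2).1 ⟨w.comap (algebraMap ↥(maximalRealSubfield L) L), K2E1HeightBigCellLineFormulaU2.isReal_comap_maximalRealSubfield L w⟩) ^ 2) : ℝ) : ℂ)) ^ (-z)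
        ∂(μE₁.prod μF₁) := ⟨_, rfl⟩
  obtain ⟨a, ha⟩ : ∃ a : HeightOneSpectrum (𝓞 ↥(maximalRealSubfield L)) → ℂ → ℂ, a = fun v z => (((((Measure.pi fun _ : Fin 3 => νv v) (integralBox ↥(maximalRealSubfield L) (Fin 3) v)).toReal⁻¹ : ℝ)) : ℂ) *
      ∫ p : Fin 3 → v.adicCompletion ↥(maximalRealSubfield L),
        ((∏ w' : PlacesOver L v, max 1 (max ((normAbs (w'.1.adicCompletion L) (quadraticLocalEquiv L v (IsCMField.complexConj L) hcδ hδ (p 0, p 1) w') : ℝ≥0) : ℝ)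
            ((normAbs (w'.1.adicCompletion L) ((toLocalRing L v (p 2) * algebraMap L (LocalRing L v) δ -
              toLocalRing L v 2⁻¹ * (quadraticLocalEquiv L v (IsCMField.complexConj L) hcδ hδ (p 0, p 1) *
                conjLocal L (IsCMField.complexConj L) v (quadraticLocalEquiv L v (IsCMField.complexConj L) hcδ hδ (p 0, p 1)))) w') : ℝ≥0) : ℝ)) : ℝ) : ℂ) ^ (-z)
          ∂(Measure.pi fun _ : Fin 3 => νv v) := ⟨_, rfl⟩
  obtain ⟨F, hF⟩ : ∃ F : ℂ → ℂ, F = fun z => (C : ℂ) * B z * (∏ v ∈ S₀, a v z) * G z := ⟨_, rfl⟩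
  have hBhol : DifferentiableOn ℂ B {z : ℂ | σ₁ < z.re} := by
    rw [hB]
    exact (differentiableOn_archMean_three L hδ μE₁ μF₁).mono hU1
  have hahol : ∀ v, DifferentiableOn ℂ (a v) {z : ℂ | σ₁ < z.re} := fun v => by
    rw [ha]
    exact (differentiableOn_localMean_of_integrable L hδ hcδ v (νv v) (fun σ hσ => hloc v (νv v) σ hσ)).const_mul _
  have hFhol : DifferentiableOn ℂ F {z : ℂ | σ₁ < z.re} := by
    rw [hF]
    exact (((differentiableOn_const _).mul hBhol).mul (DifferentiableOn.fun_finsetProd fun v _ => hahol v)).mul (hGd.mono hU1)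
  obtain ⟨hmer, hhol, hres⟩ := continuation_package_div_sub hU h2U hFhol
  have h2 : ((2 : ℝ) : ℂ) = 2 := by norm_num
  have hB2 : B 2 ≠ 0 := by  -- the real moment at `σ = 2` is positive
    have hint := integrable_arch_rpow_neg_prod_real L hδ μE₁ μF₁ (one_lt_two)
    have hpos := integral_rpow_pos (m := μE₁.prod μF₁) (fun p : InfiniteAdeleRing L × InfiniteAdeleRing ↥(maximalRealSubfield L) => lt_of_lt_of_le one_pos (one_le_arch L (δ := δ) p.1 p.2)) hint
    rw [hB]
    simp only
    rw [← h2, archMean_three_ofReal L (δ := δ) (μE₁.prod μF₁) 2]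
    exact_mod_cast hpos.ne'
  have ha2 : ∀ v, a v 2 ≠ 0 := by
    intro v
    haveI := sigmaCompactSpace_of_isNonarchimedeanLocalField (v.adicCompletion ↥(maximalRealSubfield L))
    have hbox0 : (Measure.pi fun _ : Fin 3 => νv v) (integralBox ↥(maximalRealSubfield L) (Fin 3) v) ≠ 0 :=
      ((isOpen_integralBox ↥(maximalRealSubfield L) (Fin 3) v).measure_ne_zero _ ⟨0, zero_mem_integralBox ↥(maximalRealSubfield L) (Fin 3) v⟩)
    have hboxT : (Measure.pi fun _ : Fin 3 => νv v) (integralBox ↥(maximalRealSubfield L) (Fin 3) v) ≠ ⊤ :=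
      (isCompact_integralBox ↥(maximalRealSubfield L) (Fin 3) v).measure_lt_top.ne
    have hint := hloc v (νv v) 2 hσ₁2
    have hpos := integral_rpow_pos (m := Measure.pi fun _ : Fin 3 => νv v)
      (fun p : Fin 3 → v.adicCompletion ↥(maximalRealSubfield L) => lt_of_lt_of_le one_pos (Finset.one_le_prod fun w' _ => le_max_left (1 : ℝ) (max ((normAbs (w'.1.adicCompletion L) (quadraticLocalEquiv L v (IsCMField.complexConj L) hcδ hδ (p 0, p 1) w') : ℝ≥0) : ℝ)
            ((normAbs (w'.1.adicCompletion L) ((toLocalRing L v (p 2) * algebraMap L (LocalRing L v) δ -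
              toLocalRing L v 2⁻¹ * (quadraticLocalEquiv L v (IsCMField.complexConj L) hcδ hδ (p 0, p 1) *
                conjLocal L (IsCMField.complexConj L) v (quadraticLocalEquiv L v (IsCMField.complexConj L) hcδ hδ (p 0, p 1)))) w') : ℝ≥0) : ℝ)))) hint
    rw [ha]
    simp only
    rw [← h2, localMean_cm_ofReal L hδ hcδ v (Measure.pi fun _ : Fin 3 => νv v) 2]
    refine mul_ne_zero ?_ (by exact_mod_cast hpos.ne')
    exact_mod_cast (inv_ne_zero (ENNReal.toReal_ne_zero.2 ⟨hbox0, hboxT⟩))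
  have hF2 : F 2 ≠ 0 := by
    rw [hF]
    exact mul_ne_zero (mul_ne_zero (mul_ne_zero (by exact_mod_cast hC.ne') hB2) (Finset.prod_ne_zero_iff.2 fun v _ => ha2 v)) hG2
  refine ⟨fun z => F z / (z - 2), F 2, hF2, hmer, hhol, hres, ?_⟩
  -- agreement with the scalar on `{2 < re}`: identity theorem from the real axis
  have hg : DifferentiableOn ℂ (fun z => F z / (z - 2)) {z : ℂ | (2 : ℝ) < z.re} := hhol.mono fun z hz => ⟨show σ₁ < z.re from lt_trans hσ₁2 hz, fun h => by
    have h' : z = 2 := Set.mem_singleton_iff.1 h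
    have hz' : (2 : ℝ) < z.re := hz
    rw [h', Complex.re_ofNat] at hz'
    exact lt_irrefl _ hz'⟩
  have hEq := eqOn_re_gt_of_forall_ofReal ((differentiableOn_intertwiningScalar_cm_three L ν h𝓕N h𝓕c).const_mul ((((ν 𝓕).toReal⁻¹ : ℝ)) : ℂ)) hg (fun σ hσ => ?_)
  · intro z hz
    exact (hEq hz).symm
  -- the real points: ★ FILE 3′ at `σ`
  have hT : Integrable (fun v : ↥(adelicUnipotent ↥(maximalRealSubfield L) L (IsCMField.complexConj L) 3) =>
      ((((borelHeight (((quasiSplit (↥(maximalRealSubfield L)) L (IsCMField.complexConj L) 3).toAdelic (weylLongU ((IsCMField.complexConj L : L ≃ₐ[↥(maximalRealSubfield L)] L) : L →+* L) (rfl : ((StdForm.antidiagonal 3).over L) = ((StdForm.antidiagonal 3).over L)))) * (v : (quasiSplit (↥(maximalRealSubfield L)) L (IsCMField.complexConj L) 3).Adelic))) : ℝ) ^ σ : ℝ) : ℂ)) ν := by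
    have h := Complex.ofRealCLM.integrable_comp (integrable_borelHeight_weylLongU_mul_rpow_cm_three L ν h𝓕N h𝓕c hσ 1)
    simp_rw [mul_one] at h
    exact h
  have hE := hEP S₀ hgood hσ hT
  -- currencies: `(H:ℂ)^(σ:ℂ) = ((H^σ:ℝ):ℂ)`, `•` = `*`
  have hL : ((((ν 𝓕).toReal⁻¹ : ℝ)) : ℂ) * (∫ v : ↥(adelicUnipotent (↥(maximalRealSubfield L)) L (IsCMField.complexConj L) 3), (((borelHeight (((quasiSplit (↥(maximalRealSubfield L)) L (IsCMField.complexConj L) 3).toAdelic (weylLongU ((IsCMField.complexConj L : L ≃ₐ[↥(maximalRealSubfield L)] L) : L →+* L) (rfl : (StdForm.antidiagonal 3).over L = (StdForm.antidiagonal 3).over L))) * (v : (quasiSplit (↥(maximalRealSubfield L)) L (IsCMField.complexConj L) 3).Adelic))) : ℝ) : ℂ) ^ ((σ : ℝ) : ℂ) ∂ν) =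
      ((ν 𝓕).toReal⁻¹ : ℝ) • ∫ v : ↥(adelicUnipotent ↥(maximalRealSubfield L) L (IsCMField.complexConj L) 3),
          ((((borelHeight (((quasiSplit (↥(maximalRealSubfield L)) L (IsCMField.complexConj L) 3).toAdelic (weylLongU ((IsCMField.complexConj L : L ≃ₐ[↥(maximalRealSubfield L)] L) : L →+* L) (rfl : ((StdForm.antidiagonal 3).over L) = ((StdForm.antidiagonal 3).over L)))) * (v : (quasiSplit (↥(maximalRealSubfield L)) L (IsCMField.complexConj L) 3).Adelic))) : ℝ) ^ σ : ℝ) : ℂ) ∂ν := by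
    rw [Complex.real_smul]
    congr 1
    exact integral_congr_ae (Eventually.of_forall fun v => (Complex.ofReal_cpow (NNReal.coe_nonneg _) σ).symm)
  -- the archimedean factor at `σ` is `B σ` (Fubini), the local factors are `a v σ`, and `[N∕D](σ) = G σ ∕ (σ − 2)`
  have hX : (∫ Xi : InfiniteAdeleRing L, ∫ a' : InfiniteAdeleRing ↥(maximalRealSubfield L), ((((∏ w : InfinitePlace L, ((1 + ‖(Xi) w‖ ^ 2 / 2) ^ 2 + (w δ) ^ 2 * (((InfiniteAdeleRing.ringEquiv_mixedSpace ↥(maximalRealSubfield L)) a').1 ⟨w.comap (algebraMap ↥(maximalRealSubfield L) L), K2E1HeightBigCellLineFormulaU2.isReal_comap_maximalRealSubfield L w⟩) ^ 2))) ^ (-σ) : ℝ) : ℂ) ∂μF₁ ∂μE₁) = B σ := by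
    rw [← integral_prod _ (integrable_arch_rpow_neg_prod L hδ μE₁ μF₁ (by linarith)), hB]
    simp only
    rw [archMean_three_ofReal L (δ := δ) (μE₁.prod μF₁) σ, integral_complex_ofReal]
  have hY : ∀ v, ((Measure.pi fun _ : Fin 3 => νv v) (integralBox ↥(maximalRealSubfield L) (Fin 3) v)).toReal⁻¹ •
      (∫ p : Fin 3 → v.adicCompletion ↥(maximalRealSubfield L),
        (((∏ w' : PlacesOver L v, max 1 (max ((normAbs (w'.1.adicCompletion L) (quadraticLocalEquiv L v (IsCMField.complexConj L) hcδ hδ (p 0, p 1) w') : ℝ≥0) : ℝ)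
          ((normAbs (w'.1.adicCompletion L) ((toLocalRing L v (p 2) * algebraMap L (LocalRing L v) δ -
            toLocalRing L v 2⁻¹ * (quadraticLocalEquiv L v (IsCMField.complexConj L) hcδ hδ (p 0, p 1) *
              conjLocal L (IsCMField.complexConj L) v (quadraticLocalEquiv L v (IsCMField.complexConj L) hcδ hδ (p 0, p 1)))) w') : ℝ≥0) : ℝ))) ^ (-σ) : ℝ) : ℂ)
        ∂(Measure.pi fun _ : Fin 3 => νv v)) = a v σ := by
    intro v
    rw [ha, Complex.real_smul]
    simp only
    rw [localMean_cm_ofReal L hδ hcδ v (Measure.pi fun _ : Fin 3 => νv v) σ, integral_complex_ofReal]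
  have hσ2 : ((σ : ℂ) - 2) ≠ 0 := by
    rw [show ((σ : ℂ) - 2) = ((σ - 2 : ℝ) : ℂ) by push_cast; ring]
    exact_mod_cast (show σ - 2 ≠ 0 by linarith)
  have hND := hGeq (σ : ℂ) (by rwa [Complex.ofReal_re])
  show ((((ν 𝓕).toReal⁻¹ : ℝ)) : ℂ) * (∫ v : ↥(adelicUnipotent (↥(maximalRealSubfield L)) L (IsCMField.complexConj L) 3), (((borelHeight (((quasiSplit (↥(maximalRealSubfield L)) L (IsCMField.complexConj L) 3).toAdelic (weylLongU ((IsCMField.complexConj L : L ≃ₐ[↥(maximalRealSubfield L)] L) : L →+* L) (rfl : (StdForm.antidiagonal 3).over L = (StdForm.antidiagonal 3).over L))) * (v : (quasiSplit (↥(maximalRealSubfield L)) L (IsCMField.complexConj L) 3).Adelic))) : ℝ) : ℂ) ^ ((σ : ℝ) : ℂ) ∂ν) = F σ / (σ - 2)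
  rw [hL, hE, hX, Finset.prod_congr rfl fun v _ => hY v, hF]
  simp only
  rw [eq_div_iff hσ2, ← hND]
  ring

/-! ## §4 The letter-free edition on `{3∕2 < re}` (★ (β)) -/

/-- **W5₃-B — MEROMORPHIC CONTINUATION OF THE SPHERICAL CONSTANT-TERM SCALAR OF `U(2,1)_{L∕L⁺}` TO `{Re z > 3∕2}`, NO LETTER.**  For every Haar `ν` on `N(𝔸_{L⁺})` and every fundamental
domain `𝓕` of `N(L⁺)` with compact closure there are `c̃ : ℂ → ℂ` and `r ≠ 0`: `c̃` meromorphic on `{3∕2 < re}`, holomorphic on `{3∕2 < re} ∖ {2}`, `(z − 2)·c̃(z) → r` (`z → 2`, `z ≠ 2`), and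
`c̃(z) = ν(𝓕)⁻¹·∫_{N(𝔸)} (H(ι(w₀)v) : ℂ)^z dν` for `Re z > 2` (§3 at `σ₁ = 3∕2` with ★ (β) `integrable_localHeight_rpow_cm`).  The pole at `z = 2ρ_H = 2` is genuine and the only one on `{3∕2 < re}`.
[cite: MoeglinWaldspurger1995, IV.1.11] [cite: Langlands1976, Appendix] [cite: Garrett2018, §2.8–§2.11] -/
theorem sphericalConstantTerm_continuation_cm_three {δ : L} (hcδ : IsCMField.complexConj L δ = -δ) (hδ : δ ≠ 0)
    (ν : Measure ↥(adelicUnipotent (↥(maximalRealSubfield L)) L (IsCMField.complexConj L) 3)) [ν.IsHaarMeasure]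
    {𝓕 : Set ↥(adelicUnipotent (↥(maximalRealSubfield L)) L (IsCMField.complexConj L) 3)} (h𝓕N : IsFundamentalDomain ↥(rationalUnipotent (↥(maximalRealSubfield L)) L (IsCMField.complexConj L) 3) 𝓕 ν)
    (h𝓕c : IsCompact (closure 𝓕)) :
    ∃ c : ℂ → ℂ, ∃ r : ℂ, r ≠ 0 ∧ MeromorphicOn c {z : ℂ | 3 / 2 < z.re} ∧ DifferentiableOn ℂ c ({z : ℂ | 3 / 2 < z.re} \ {2}) ∧
      Tendsto (fun z : ℂ => (z - 2) * c z) (𝓝[≠] 2) (𝓝 r) ∧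
      ∀ z : ℂ, 2 < z.re → c z = ((((ν 𝓕).toReal⁻¹ : ℝ)) : ℂ) * ∫ v : ↥(adelicUnipotent (↥(maximalRealSubfield L)) L (IsCMField.complexConj L) 3), (((borelHeight (((quasiSplit (↥(maximalRealSubfield L)) L (IsCMField.complexConj L) 3).toAdelic (weylLongU ((IsCMField.complexConj L : L ≃ₐ[↥(maximalRealSubfield L)] L) : L →+* L) (rfl : (StdForm.antidiagonal 3).over L = (StdForm.antidiagonal 3).over L))) * (v : (quasiSplit (↥(maximalRealSubfield L)) L (IsCMField.complexConj L) 3).Adelic))) : ℝ) : ℂ) ^ z ∂ν := by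
  have hdmem : δ * δ ∈ maximalRealSubfield L := by
    rw [← IsCMField.complexConj_eq_self_iff, map_mul, hcδ, neg_mul_neg]
  have hd : δ * δ = algebraMap ↥(maximalRealSubfield L) L ⟨δ * δ, hdmem⟩ := rfl
  exact sphericalConstantTerm_continuation_cm_three_of_local L hcδ hδ (by norm_num) (by norm_num)
    (fun v _ _ νv _ σ hσ => integrable_localHeight_rpow_cm L hcδ hδ hd v νv hσ) ν h𝓕N h𝓕c

end Summit.HodgeConjecture.HodgeConjecture.Cruxes.H413.K2E1SphericalConstantTermContinuationU3

end
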